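import Literature.NumberTheory.GelbartRogawski1991.LocalDoubledAnisotropicFactorisation
import Literature.NumberTheory.GelbartRogawski1991.UnitaryDualPairThetaKernelCM
import Literature.NumberTheory.Automorphic.LocalUnitaryGroupUnimodularOfAdelic
import Literature.NumberTheory.Automorphic.UnitaryGroupPureTensorEulerProduct
import Literature.RepresentationTheory.WeilBruhatInvariantFunctional
import HarnessLib

/-!
# The invariant functional on the `Δ_{P_Δ}`-densities of the rank-one doubled unitary group `U(W ⊕ −W)(F_v)`

Topic `NumberTheory/GelbartRogawski1991`; namespace `Literature.NumberTheory.GelbartRogawski1991.UnitaryDualPair.LocalSplitting`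
(that of ★ `LocalDoubledUnitaryDatum` ∕ `LocalDoubledUnitarySiegel` ∕ `LocalDoubledAnisotropicFactorisation`).  KERNEL MATHEMATICS ONLY:
theorems, no definition, no named fact, no instance, no `sorry`.

Setting: `E/F` quadratic with conjugation `c` (CM data `(δ, d)`), a finite place `v`, a symmetric invertible `T₁ ∈ M₁(F)` (a hermitian LINE
`W = T₁ ⊗ 1`), the doubled group `G = U(W ⊕ −W)(F_v) = UnitaryGroup.localPi E c (1 + 1) J^𝔻 v` (`J^𝔻 = (T₁ ⊕ −T₁) ⊗ 1`, ★ `gramD`), a rank-2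
quasi-split unitary group, and a bundled copy `P ≤ G` of its Siegel parabolic `P_Δ(F_v)` (`∀ h, h ∈ P ↔ IsSiegelDelta … h`, the predicate
form of ★ `LocalDoubledAnisotropicFactorisation` §3).  This file DOCKS the group-agnostic Weil–Bruhat invariant functional
(★ `WeilBruhatInvariantFunctional`: `exists_leftInvariant_functional` ∕ `exists_rightInvariant_functional`) on `(G, P)`:

* §1 **unimodularity**: every rank-2 local unitary group in the factor form `localPi L c̄ 2 J v` (`L` CM, `J ∈ M₂(L)` hermitian, `det J ≠ 0`) has
  trivial modular function (`modularCharacter_localPi_two_eq_one`: ★ `UnitaryGroup.modularCharacter_cmDatum_local_two_eq_one` — carrier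
  `(cmDatum L 2 J).Local v = ↥(«local» …)`, ★ `cmDatum_Local` — transported along ★ `localPiEquiv` by ★ `modularCharacter_continuousMulEquiv`),
  so its Haar measures are right invariant (`isMulRightInvariant_localPi_two`); the doubled line `J^𝔻 = (T₁ ⊕ −T₁) ⊗ 1` is such a `J`
  (`conjTranspose_gramD_map`, `det_gramD_map_ne_zero`, `modularCharacter_localPi_gramD_one_eq_one`, `isMulRightInvariant_localPi_gramD_one`).
* §2 **`P_Δ(F_v)` is closed** (`isClosed_setOf_isSiegelDelta`, every rank: ★ `isSiegelDelta_iff_blocks` — the block condition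
  `h₁₁ + h₁₂ = h₂₁ + h₂₂` at every `w ∣ v` is a closed condition), hence every bundled copy `P` is closed and locally compact
  (`isClosed_of_isSiegelDelta`, `locallyCompactSpace_of_isSiegelDelta`, ★ `locallyCompactSpace_localPi`).
* §3 **THE INVARIANT FUNCTIONAL** on `G = U(W ⊕ −W)(F_v)` at a NON-SPLIT `v` (`IsField (E ⊗ F_v)`; `U(W)(F_v) = E_v¹` compact, an instance
  hypothesis discharged by ★ `Liu2021.compactSpace_localPi_one_of_smul_eq`): for a Haar measure `μ` on `G` that is right invariant and any bundled
  `P = P_Δ`, there is `I : (G → ℂ) → ℂ`, additive and homogeneous on continuous functions, with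
  — LEFT orientation (`exists_leftInvariant_functional_of_isSiegelDelta`): `I (f (h ·)) = I f` for every continuous `Δ_P`-density
    `f (x p) = Δ_P(p)⁻¹ f x` and `0 < re (I f)` for such `f` real-non-negative-valued and `≢ 0`;
  — RIGHT orientation (`exists_rightInvariant_functional_of_isSiegelDelta`): `I (f (· h)) = I f` for every continuous LEFT-`Δ_P`-EQUIVARIANT
    `f (p x) = Δ_P(p) f x`, same positivity;
  (`Δ_P` = Mathlib's `modularCharacter` of `↥P`, continuous by ★ `continuous_modularCharacter`; `G ⧸ P` compact by ★
  `compactSpace_quotient_of_isSiegelDelta` with ★ `anisotropic_gramS_of_rank_one`; `G` locally compact second countable ★).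
  CM SPECIALISATION (`L/L⁺`, `c̄`, `δ = imagUnit L`; `…_cm`): the right-invariance hypothesis on `μ` is DISCHARGED by §1.

USE (cell hodgecm-mathlib, half A line LD2, plate «(S7b) DOCK» of LD2-plan (g2); consumer B-p04 (g44)'s (J1) junction of the SOFT road (π3) to
the pin (P) of [Liu2021, Lem. D.1 (1)]): with `V` the letter's anisotropic hermitian PLANE, `V ⊕ −V = V ⊗ (W ⊕ −W)` (`W = ⟨1⟩`), the
`Δ`-functional `λ` of `U(V ⊕ −V)` pulled back along `h ↦ 1_V ⊗ h` gives `f_Φ(h) = λ(ω(s′(1_V ⊗ h)) Φ)` on `G = U(W ⊕ −W)(L⁺_v)`, continuous and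
left-`P_Δ`-equivariant with character `‖det_Δ^{(2)}(1_V ⊗ p)‖^{1∕2} = ‖det_Δ p‖ = Δ_{P_Δ}(p)` (the sequel «Siegel = Borel transport»,
`Δ_{P_Δ} = ‖det_Δ‖`), and `f_{ω(g)Φ} = f_Φ(· g)`; §3 makes `Φ ↦ I(f_Φ)` a `G`-invariant linear functional, non-zero on a spherical `Φ` with
`λ(Φ) ≠ 0`.  HONEST LABEL: nothing of [Liu2021] is asserted here; HC_CM is proved only modulo the 7 printed citations (2 remaining: hLiu418 =
stmt-HodgeConjecture-24832, h413 = stmt-HodgeConjecture-24833) until rung 0 closes; count-neutral.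

## References
* [WeilIntegration1965] A. Weil, *L'intégration dans les groupes topologiques et ses applications* (1940/1965), §9.
* [BourbakiINT7] N. Bourbaki, *Intégration, Chap. VII–VIII*, Chap. VII §2 n° 5–8.
* [GelbartPiatetskishapiroRallis1987] S. Gelbart, I. Piatetski-Shapiro, S. Rallis, LNM 1254 (1987), Part A §2 Lemma 2.1 p. 8.
* [Kudla1994] S. S. Kudla, Israel J. Math. 87 (1994) 361–401, §3.
* [Rogawski1990] J. Rogawski, *Automorphic Representations of Unitary Groups in Three Variables* (1990), §4.9 p. 54.
* [PlatonovRapinchuk1994] V. Platonov, A. Rapinchuk, *Algebraic Groups and Number Theory* (1994), §3.1, §5.1.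
-/

set_option autoImplicit false

noncomputable section

open NumberField IsDedekindDomain Matrix MeasureTheory
open scoped NNReal
open Literature.NumberTheory.Automorphic Literature.NumberTheory.Automorphic.UnitaryGroup
open Literature.RepresentationTheory.WeilBruhat

namespace Literature.NumberTheory.GelbartRogawski1991.UnitaryDualPair.LocalSplitting

/-! ## §1 Rank-2 local unitary groups in the factor form `localPi` are unimodular; the doubled line -/

section Unimodular

variable (L : Type) [Field L] [NumberField L] [IsCMField L] (v : HeightOneSpectrum (𝓞 ↥(maximalRealSubfield L)))

/-- **`U(J)(L⁺_v)` is unimodular in rank 2, factor form**: for `J ∈ M₂(L)` hermitian with `det J ≠ 0`, the modular function of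
`localPi L c̄ 2 J v ≤ Π_{w ∣ v} GL₂(L_w)` is trivial — ★ `modularCharacter_cmDatum_local_two_eq_one` (global isotropic ∕ anisotropic dichotomy)
on the carrier `(cmDatum L 2 J).Local v = ↥(«local» L c̄ 2 J v)`, transported along ★ `localPiEquiv : localPi ≃ₜ* «local»`
(★ `modularCharacter_continuousMulEquiv`). [cite: Rogawski1990, §4.9 p. 54] [cite: PlatonovRapinchuk1994, §5.1] -/
theorem modularCharacter_localPi_two_eq_one (J : Matrix (Fin 2) (Fin 2) L) (hJ : (J.map (cmConjRingHom L))ᵀ = J) (hdet : J.det ≠ 0)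
    [LocallyCompactSpace (localPi L (IsCMField.complexConj L) 2 J v)] (h : localPi L (IsCMField.complexConj L) 2 J v) :
    Measure.modularCharacter h = 1 := by
  rw [← MeasureTheory.Measure.modularCharacter_continuousMulEquiv (localPiEquiv L (IsCMField.complexConj L) 2 J v) h]
  exact modularCharacter_cmDatum_local_two_eq_one L v J hJ hdet _

/-- every Haar measure on `localPi L c̄ 2 J v` (`J ∈ M₂(L)` hermitian, `det J ≠ 0`) is RIGHT invariant. [cite: Rogawski1990, §4.9 p. 54] -/
theorem isMulRightInvariant_localPi_two (J : Matrix (Fin 2) (Fin 2) L) (hJ : (J.map (cmConjRingHom L))ᵀ = J) (hdet : J.det ≠ 0)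
    [MeasurableSpace (localPi L (IsCMField.complexConj L) 2 J v)] [BorelSpace (localPi L (IsCMField.complexConj L) 2 J v)]
    (ν : Measure (localPi L (IsCMField.complexConj L) 2 J v)) [ν.IsHaarMeasure] : ν.IsMulRightInvariant := by
  haveI := locallyCompactSpace_localPi L 2 (IsCMField.complexConj L) J v
  haveI := secondCountableTopology_localPi L 2 (IsCMField.complexConj L) J v
  exact isMulRightInvariant_of_modularCharacterFun_eq_one (fun x => modularCharacter_localPi_two_eq_one L v J hJ hdet x) ν

/-- the doubled Gram matrix `J^𝔻 = (T₀ ⊕ −T₀) ⊗ 1 ∈ M_{n+n}(L)` of a symmetric `T₀ ∈ M_n(L⁺)` is HERMITIAN (`c̄` fixes `L⁺`, `T^𝔻` is symmetric,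
★ `gramD_isSymm`). [cite: Kudla1994, §3] -/
theorem conjTranspose_gramD_map (n : ℕ) {T₀ : Matrix (Fin n) (Fin n) ↥(maximalRealSubfield L)} (hT₀ : T₀.IsSymm) :
    (((gramD (↥(maximalRealSubfield L)) n T₀).map (algebraMap (↥(maximalRealSubfield L)) L)).map (cmConjRingHom L))ᵀ =
      (gramD (↥(maximalRealSubfield L)) n T₀).map (algebraMap (↥(maximalRealSubfield L)) L) := by
  rw [Matrix.map_map]
  have hc : ⇑(cmConjRingHom L) ∘ ⇑(algebraMap (↥(maximalRealSubfield L)) L) = ⇑(algebraMap (↥(maximalRealSubfield L)) L) :=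
    funext fun a => cmConjRingHom_algebraMap L a
  rw [hc, ← Matrix.transpose_map, (gramD_isSymm (↥(maximalRealSubfield L)) n hT₀).eq]

omit [NumberField L] [IsCMField L] in
/-- `det J^𝔻 ≠ 0` when `det T₀` is a unit (★ `isUnit_det_gramD`). [cite: Kudla1994, §3] -/
theorem det_gramD_map_ne_zero (n : ℕ) {T₀ : Matrix (Fin n) (Fin n) ↥(maximalRealSubfield L)} (hT₀d : IsUnit T₀.det) :
    ((gramD (↥(maximalRealSubfield L)) n T₀).map (algebraMap (↥(maximalRealSubfield L)) L)).det ≠ 0 := by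
  have h := (isUnit_det_gramD (↥(maximalRealSubfield L)) n hT₀d).map (algebraMap (↥(maximalRealSubfield L)) L)
  rw [RingHom.map_det, RingHom.mapMatrix_apply] at h
  exact h.ne_zero

/-- **the rank-one doubled group `U(W ⊕ −W)(L⁺_v) = localPi L c̄ (1+1) J^𝔻 v` is unimodular** (`W = T₁ ⊗ 1` a hermitian line).
[cite: Rogawski1990, §4.9 p. 54] [cite: Kudla1994, §3] -/
theorem modularCharacter_localPi_gramD_one_eq_one {T₁ : Matrix (Fin 1) (Fin 1) ↥(maximalRealSubfield L)} (hT₁ : T₁.IsSymm)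
    (hT₁d : IsUnit T₁.det) {JD₁ : Matrix (Fin (1 + 1)) (Fin (1 + 1)) L}
    (hJD₁ : JD₁ = (gramD (↥(maximalRealSubfield L)) 1 T₁).map (algebraMap (↥(maximalRealSubfield L)) L))
    [LocallyCompactSpace (localPi L (IsCMField.complexConj L) (1 + 1) JD₁ v)] (h : localPi L (IsCMField.complexConj L) (1 + 1) JD₁ v) :
    Measure.modularCharacter h = 1 := by
  subst hJD₁
  exact modularCharacter_localPi_two_eq_one L v _ (conjTranspose_gramD_map L 1 hT₁) (det_gramD_map_ne_zero L 1 hT₁d) h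

/-- every Haar measure on the rank-one doubled group `U(W ⊕ −W)(L⁺_v)` is RIGHT invariant. [cite: Rogawski1990, §4.9 p. 54] -/
theorem isMulRightInvariant_localPi_gramD_one {T₁ : Matrix (Fin 1) (Fin 1) ↥(maximalRealSubfield L)} (hT₁ : T₁.IsSymm)
    (hT₁d : IsUnit T₁.det) {JD₁ : Matrix (Fin (1 + 1)) (Fin (1 + 1)) L}
    (hJD₁ : JD₁ = (gramD (↥(maximalRealSubfield L)) 1 T₁).map (algebraMap (↥(maximalRealSubfield L)) L))
    [MeasurableSpace (localPi L (IsCMField.complexConj L) (1 + 1) JD₁ v)] [BorelSpace (localPi L (IsCMField.complexConj L) (1 + 1) JD₁ v)]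
    (ν : Measure (localPi L (IsCMField.complexConj L) (1 + 1) JD₁ v)) [ν.IsHaarMeasure] : ν.IsMulRightInvariant := by
  haveI := locallyCompactSpace_localPi L (1 + 1) (IsCMField.complexConj L) JD₁ v
  haveI := secondCountableTopology_localPi L (1 + 1) (IsCMField.complexConj L) JD₁ v
  exact isMulRightInvariant_of_modularCharacterFun_eq_one
    (fun x => modularCharacter_localPi_gramD_one_eq_one L v hT₁ hT₁d hJD₁ x) ν

end Unimodular

/-! ## §2 `P_Δ(F_v)` is closed; bundled copies are closed and locally compact -/

section Closed

variable (F : Type) [Field F] [NumberField F] (E : Type) [Field E] [NumberField E] [Algebra F E]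
  [Algebra.IsQuadraticExtension F E] (c : E ≃ₐ[F] E)
  {δ : E} (hcδ : c δ = -δ) (hδ : δ ≠ 0) {d : F} (hd : δ * δ = algebraMap F E d)
  (v : HeightOneSpectrum (𝓞 F)) (n : ℕ) {T₀ : Matrix (Fin n) (Fin n) F} (hT₀ : T₀.IsSymm)
  {JD : Matrix (Fin (n + n)) (Fin (n + n)) E} (hJD : JD = (gramD F n T₀).map (algebraMap F E))

/-- **the Siegel parabolic `P_Δ(F_v) = {h | IsSiegelDelta h}` is CLOSED in `H(F_v) = U(J^𝔻)(F_v)`** (every rank `n`): by ★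
`isSiegelDelta_iff_blocks` it is cut out by the continuous matrix equations `h₁₁ + h₁₂ = h₂₁ + h₂₂` on the `e₂`-blocks of `h_w`, `w ∣ v`.
[cite: Kudla1994, §3] [cite: HarrisKudlaSweet1996, §1 (1.11)] -/
theorem isClosed_setOf_isSiegelDelta :
    IsClosed {h : UnitaryGroup.localPi E c (n + n) JD v | IsSiegelDelta F E c hcδ hδ hd v n hT₀ hJD h} := by
  simp only [isSiegelDelta_iff_blocks, Set.setOf_forall]
  refine isClosed_iInter fun w => ?_
  have hc : Continuous fun h : UnitaryGroup.localPi E c (n + n) JD v =>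
      Matrix.reindex (e₂ n).symm (e₂ n).symm
        (((h : UnitaryGroup.LocalGLPi E (n + n) v) w : GL (Fin (n + n)) (w.1.adicCompletion E)) :
          Matrix (Fin (n + n)) (Fin (n + n)) (w.1.adicCompletion E)) :=
    (Units.continuous_val.comp ((continuous_apply w).comp continuous_subtype_val)).matrix_reindex _ _
  exact isClosed_eq ((hc.matrix_submatrix Sum.inl Sum.inl).add (hc.matrix_submatrix Sum.inl Sum.inr))
    ((hc.matrix_submatrix Sum.inr Sum.inl).add (hc.matrix_submatrix Sum.inr Sum.inr))

/-- every bundled copy `P ≤ H(F_v)` of `P_Δ(F_v)` (`∀ h, h ∈ P ↔ IsSiegelDelta h`) is closed. [cite: Kudla1994, §3] -/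
theorem isClosed_of_isSiegelDelta (P : Subgroup (UnitaryGroup.localPi E c (n + n) JD v))
    (hP : ∀ h, h ∈ P ↔ IsSiegelDelta F E c hcδ hδ hd v n hT₀ hJD h) :
    IsClosed (P : Set (UnitaryGroup.localPi E c (n + n) JD v)) := by
  have hPs : (P : Set (UnitaryGroup.localPi E c (n + n) JD v)) =
      {h | IsSiegelDelta F E c hcδ hδ hd v n hT₀ hJD h} := Set.ext fun h => hP h
  rw [hPs]
  exact isClosed_setOf_isSiegelDelta F E c hcδ hδ hd v n hT₀ hJD

/-- every bundled copy `P` of `P_Δ(F_v)` is locally compact (closed in the locally compact `H(F_v)`, ★ `locallyCompactSpace_localPi`).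
[cite: Kudla1994, §3] [cite: PlatonovRapinchuk1994, §3.1] -/
theorem locallyCompactSpace_of_isSiegelDelta (P : Subgroup (UnitaryGroup.localPi E c (n + n) JD v))
    (hP : ∀ h, h ∈ P ↔ IsSiegelDelta F E c hcδ hδ hd v n hT₀ hJD h) : LocallyCompactSpace P := by
  haveI := locallyCompactSpace_localPi E (n + n) c JD v
  exact (isClosed_of_isSiegelDelta F E c hcδ hδ hd v n hT₀ hJD P hP).locallyCompactSpace

end Closed

/-! ## §3 The invariant functional on the `Δ_{P_Δ}`-densities of `U(W ⊕ −W)(F_v)` at a non-split place -/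

section Functional

variable (F : Type) [Field F] [NumberField F] (E : Type) [Field E] [NumberField E] [Algebra F E]
  [Algebra.IsQuadraticExtension F E] (c : E ≃ₐ[F] E)
  {δ : E} (hcδ : c δ = -δ) (hδ : δ ≠ 0) {d : F} (hd : δ * δ = algebraMap F E d)
  (v : HeightOneSpectrum (𝓞 F)) {T₁ : Matrix (Fin 1) (Fin 1) F} (hT₁ : T₁.IsSymm) (hT₁d : IsUnit T₁.det)
  {J₁ : Matrix (Fin 1) (Fin 1) E} (hJ₁ : J₁ = T₁.map (algebraMap F E))
  {JD₁ : Matrix (Fin (1 + 1)) (Fin (1 + 1)) E} (hJD₁ : JD₁ = (gramD F 1 T₁).map (algebraMap F E))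

include hT₁d hJ₁ in
/-- **THE INVARIANT FUNCTIONAL ON `U(W ⊕ −W)(F_v) ⧸ P_Δ`, LEFT ORIENTATION** (`v` non-split; `U(W)(F_v)` compact; `μ` a Haar measure on
`G = U(W ⊕ −W)(F_v)` that is also right invariant — automatic in the CM setting, `…_cm` below; `P` a bundled copy of `P_Δ(F_v)`, locally
compact by `locallyCompactSpace_of_isSiegelDelta`): there is `I : (G → ℂ) → ℂ`, additive and homogeneous on continuous functions, with
`I (f (h ·)) = I f` for every continuous `Δ_P`-density `f` (`f (x p) = Δ_P(p)⁻¹ f x`) and `0 < re (I f)` for such `f` real-non-negative with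
`f x₀ ≠ 0` somewhere (★ `WeilBruhat.exists_leftInvariant_functional`; `G ⧸ P` compact ★ `compactSpace_quotient_of_isSiegelDelta`, `P` closed §2,
`Δ_P` continuous ★ `continuous_modularCharacter`). [cite: WeilIntegration1965, §9] [cite: GelbartPiatetskishapiroRallis1987, Part A §2 Lemma 2.1 p. 8] -/
theorem exists_leftInvariant_functional_of_isSiegelDelta (hE : IsField (LocalRing E v))
    [CompactSpace (UnitaryGroup.localPi E c 1 J₁ v)]
    [MeasurableSpace (UnitaryGroup.localPi E c (1 + 1) JD₁ v)] [BorelSpace (UnitaryGroup.localPi E c (1 + 1) JD₁ v)]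
    (μ : Measure (UnitaryGroup.localPi E c (1 + 1) JD₁ v)) [μ.IsHaarMeasure] [μ.IsMulRightInvariant]
    (P : Subgroup (UnitaryGroup.localPi E c (1 + 1) JD₁ v)) (hP : ∀ h, h ∈ P ↔ IsSiegelDelta F E c hcδ hδ hd v 1 hT₁ hJD₁ h)
    [LocallyCompactSpace P] :
    ∃ I : (UnitaryGroup.localPi E c (1 + 1) JD₁ v → ℂ) → ℂ,
      (∀ f g : UnitaryGroup.localPi E c (1 + 1) JD₁ v → ℂ, Continuous f → Continuous g → I (f + g) = I f + I g) ∧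
      (∀ (a : ℂ) (f : UnitaryGroup.localPi E c (1 + 1) JD₁ v → ℂ), I (a • f) = a * I f) ∧
      (∀ f : UnitaryGroup.localPi E c (1 + 1) JD₁ v → ℂ, Continuous f → IsDensity P Measure.modularCharacter f →
        ∀ h : UnitaryGroup.localPi E c (1 + 1) JD₁ v, I (fun x => f (h * x)) = I f) ∧
      (∀ f : UnitaryGroup.localPi E c (1 + 1) JD₁ v → ℂ, Continuous f → IsDensity P Measure.modularCharacter f →
        (∀ x, f x = ((f x).re : ℂ) ∧ 0 ≤ (f x).re) → ∀ x₀, f x₀ ≠ 0 → 0 < (I f).re) := by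
  haveI := locallyCompactSpace_localPi E (1 + 1) c JD₁ v
  haveI := secondCountableTopology_localPi E (1 + 1) c JD₁ v
  haveI : CompactSpace (UnitaryGroup.localPi E c (1 + 1) JD₁ v ⧸ P) :=
    compactSpace_quotient_of_isSiegelDelta F E c hcδ hδ hd v 1 hT₁ hJ₁ hJD₁ hE (anisotropic_gramS_of_rank_one F E c v hE hT₁d) P hP
  exact exists_leftInvariant_functional P μ (isClosed_of_isSiegelDelta F E c hcδ hδ hd v 1 hT₁ hJD₁ P hP)
    Literature.MeasureTheory.Group.continuous_modularCharacter

include hT₁d hJ₁ in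
/-- **THE INVARIANT FUNCTIONAL ON `P_Δ \ U(W ⊕ −W)(F_v)`, RIGHT ORIENTATION** (same hypotheses): there is `I : (G → ℂ) → ℂ`, additive and
homogeneous on continuous functions, with `I (f (· h)) = I f` for every continuous LEFT-`Δ_P`-EQUIVARIANT `f` (`f (p x) = Δ_P(p) f x`,
`p ∈ P`) and `0 < re (I f)` for such `f` real-non-negative with `f x₀ ≠ 0` somewhere — the orientation of the coefficients `h ↦ λ(ω(s′ h) Φ)` of
a `P_Δ`-eigenfunctional `λ` (★ `WeilBruhat.exists_rightInvariant_functional`).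
[cite: WeilIntegration1965, §9] [cite: GelbartPiatetskishapiroRallis1987, Part A §2 Lemma 2.1 p. 8] -/
theorem exists_rightInvariant_functional_of_isSiegelDelta (hE : IsField (LocalRing E v))
    [CompactSpace (UnitaryGroup.localPi E c 1 J₁ v)]
    [MeasurableSpace (UnitaryGroup.localPi E c (1 + 1) JD₁ v)] [BorelSpace (UnitaryGroup.localPi E c (1 + 1) JD₁ v)]
    (μ : Measure (UnitaryGroup.localPi E c (1 + 1) JD₁ v)) [μ.IsHaarMeasure] [μ.IsMulRightInvariant]
    (P : Subgroup (UnitaryGroup.localPi E c (1 + 1) JD₁ v)) (hP : ∀ h, h ∈ P ↔ IsSiegelDelta F E c hcδ hδ hd v 1 hT₁ hJD₁ h)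
    [LocallyCompactSpace P] :
    ∃ I : (UnitaryGroup.localPi E c (1 + 1) JD₁ v → ℂ) → ℂ,
      (∀ f g : UnitaryGroup.localPi E c (1 + 1) JD₁ v → ℂ, Continuous f → Continuous g → I (f + g) = I f + I g) ∧
      (∀ (a : ℂ) (f : UnitaryGroup.localPi E c (1 + 1) JD₁ v → ℂ), I (a • f) = a * I f) ∧
      (∀ f : UnitaryGroup.localPi E c (1 + 1) JD₁ v → ℂ, Continuous f →
        (∀ (p : P) (x : UnitaryGroup.localPi E c (1 + 1) JD₁ v),
          f ((p : UnitaryGroup.localPi E c (1 + 1) JD₁ v) * x) = ((Measure.modularCharacter p : ℝ) : ℂ) * f x) →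
        ∀ h : UnitaryGroup.localPi E c (1 + 1) JD₁ v, I (fun x => f (x * h)) = I f) ∧
      (∀ f : UnitaryGroup.localPi E c (1 + 1) JD₁ v → ℂ, Continuous f →
        (∀ (p : P) (x : UnitaryGroup.localPi E c (1 + 1) JD₁ v),
          f ((p : UnitaryGroup.localPi E c (1 + 1) JD₁ v) * x) = ((Measure.modularCharacter p : ℝ) : ℂ) * f x) →
        (∀ x, f x = ((f x).re : ℂ) ∧ 0 ≤ (f x).re) → ∀ x₀, f x₀ ≠ 0 → 0 < (I f).re) := by
  haveI := locallyCompactSpace_localPi E (1 + 1) c JD₁ v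
  haveI := secondCountableTopology_localPi E (1 + 1) c JD₁ v
  haveI : CompactSpace (UnitaryGroup.localPi E c (1 + 1) JD₁ v ⧸ P) :=
    compactSpace_quotient_of_isSiegelDelta F E c hcδ hδ hd v 1 hT₁ hJ₁ hJD₁ hE (anisotropic_gramS_of_rank_one F E c v hE hT₁d) P hP
  exact exists_rightInvariant_functional P μ (isClosed_of_isSiegelDelta F E c hcδ hδ hd v 1 hT₁ hJD₁ P hP)
    Literature.MeasureTheory.Group.continuous_modularCharacter

end Functional

/-! ## §4 CM specialisation: `E/F = L/L⁺`, `c = c̄`, `δ = imagUnit L` — unimodularity discharged -/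

section CM

variable (L : Type) [Field L] [NumberField L] [IsCMField L] (v : HeightOneSpectrum (𝓞 ↥(maximalRealSubfield L)))
  {T₁ : Matrix (Fin 1) (Fin 1) ↥(maximalRealSubfield L)} (hT₁ : T₁.IsSymm) (hT₁d : IsUnit T₁.det)
  {J₁ : Matrix (Fin 1) (Fin 1) L} (hJ₁ : J₁ = T₁.map (algebraMap (↥(maximalRealSubfield L)) L))
  {JD₁ : Matrix (Fin (1 + 1)) (Fin (1 + 1)) L}
  (hJD₁ : JD₁ = (gramD (↥(maximalRealSubfield L)) 1 T₁).map (algebraMap (↥(maximalRealSubfield L)) L))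

include hT₁d hJ₁ in
/-- **CM SETTING, LEFT ORIENTATION**: on `G = U(W ⊕ −W)(L⁺_v) = localPi L c̄ (1+1) J^𝔻 v` at a non-split `v` (`U(W)(L⁺_v) = L_v¹` compact),
for ANY Haar measure `μ` (right invariant by §1) and any bundled `P = P_Δ` (`δ = imagUnit L`), the invariant functional of
`exists_leftInvariant_functional_of_isSiegelDelta`. [cite: WeilIntegration1965, §9] [cite: Rogawski1990, §4.9 p. 54] -/
theorem exists_leftInvariant_functional_of_isSiegelDelta_cm (hE : IsField (LocalRing L v))
    [CompactSpace (UnitaryGroup.localPi L (IsCMField.complexConj L) 1 J₁ v)]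
    [MeasurableSpace (UnitaryGroup.localPi L (IsCMField.complexConj L) (1 + 1) JD₁ v)]
    [BorelSpace (UnitaryGroup.localPi L (IsCMField.complexConj L) (1 + 1) JD₁ v)]
    (μ : Measure (UnitaryGroup.localPi L (IsCMField.complexConj L) (1 + 1) JD₁ v)) [μ.IsHaarMeasure]
    (P : Subgroup (UnitaryGroup.localPi L (IsCMField.complexConj L) (1 + 1) JD₁ v))
    (hP : ∀ h, h ∈ P ↔ IsSiegelDelta (↥(maximalRealSubfield L)) L (IsCMField.complexConj L) (complexConj_imagUnit L)
      (imagUnit_ne_zero L) (imagUnit_mul_self L) v 1 hT₁ hJD₁ h)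
    [LocallyCompactSpace P] :
    ∃ I : (UnitaryGroup.localPi L (IsCMField.complexConj L) (1 + 1) JD₁ v → ℂ) → ℂ,
      (∀ f g : UnitaryGroup.localPi L (IsCMField.complexConj L) (1 + 1) JD₁ v → ℂ,
        Continuous f → Continuous g → I (f + g) = I f + I g) ∧
      (∀ (a : ℂ) (f : UnitaryGroup.localPi L (IsCMField.complexConj L) (1 + 1) JD₁ v → ℂ), I (a • f) = a * I f) ∧
      (∀ f : UnitaryGroup.localPi L (IsCMField.complexConj L) (1 + 1) JD₁ v → ℂ, Continuous f →
        IsDensity P Measure.modularCharacter f →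
        ∀ h : UnitaryGroup.localPi L (IsCMField.complexConj L) (1 + 1) JD₁ v, I (fun x => f (h * x)) = I f) ∧
      (∀ f : UnitaryGroup.localPi L (IsCMField.complexConj L) (1 + 1) JD₁ v → ℂ, Continuous f →
        IsDensity P Measure.modularCharacter f →
        (∀ x, f x = ((f x).re : ℂ) ∧ 0 ≤ (f x).re) → ∀ x₀, f x₀ ≠ 0 → 0 < (I f).re) := by
  haveI := isMulRightInvariant_localPi_gramD_one L v hT₁ hT₁d hJD₁ μ
  exact exists_leftInvariant_functional_of_isSiegelDelta (↥(maximalRealSubfield L)) L (IsCMField.complexConj L)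
    (complexConj_imagUnit L) (imagUnit_ne_zero L) (imagUnit_mul_self L) v hT₁ hT₁d hJ₁ hJD₁ hE μ P hP

include hT₁d hJ₁ in
/-- **CM SETTING, RIGHT ORIENTATION** (B-p04's dock): on `G = U(W ⊕ −W)(L⁺_v)` at a non-split `v`, for ANY Haar measure `μ` and any bundled
`P = P_Δ`, there is `I : (G → ℂ) → ℂ`, additive and homogeneous on continuous functions, RIGHT-INVARIANT `I (f (· h)) = I f` on every
continuous left-`Δ_P`-equivariant `f (p x) = Δ_P(p) f x`, and POSITIVE `0 < re (I f)` on such `f` real-non-negative with `f x₀ ≠ 0`.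
[cite: WeilIntegration1965, §9] [cite: Rogawski1990, §4.9 p. 54] [cite: GelbartPiatetskishapiroRallis1987, Part A §2 Lemma 2.1 p. 8] -/
theorem exists_rightInvariant_functional_of_isSiegelDelta_cm (hE : IsField (LocalRing L v))
    [CompactSpace (UnitaryGroup.localPi L (IsCMField.complexConj L) 1 J₁ v)]
    [MeasurableSpace (UnitaryGroup.localPi L (IsCMField.complexConj L) (1 + 1) JD₁ v)]
    [BorelSpace (UnitaryGroup.localPi L (IsCMField.complexConj L) (1 + 1) JD₁ v)]
    (μ : Measure (UnitaryGroup.localPi L (IsCMField.complexConj L) (1 + 1) JD₁ v)) [μ.IsHaarMeasure]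
    (P : Subgroup (UnitaryGroup.localPi L (IsCMField.complexConj L) (1 + 1) JD₁ v))
    (hP : ∀ h, h ∈ P ↔ IsSiegelDelta (↥(maximalRealSubfield L)) L (IsCMField.complexConj L) (complexConj_imagUnit L)
      (imagUnit_ne_zero L) (imagUnit_mul_self L) v 1 hT₁ hJD₁ h)
    [LocallyCompactSpace P] :
    ∃ I : (UnitaryGroup.localPi L (IsCMField.complexConj L) (1 + 1) JD₁ v → ℂ) → ℂ,
      (∀ f g : UnitaryGroup.localPi L (IsCMField.complexConj L) (1 + 1) JD₁ v → ℂ,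
        Continuous f → Continuous g → I (f + g) = I f + I g) ∧
      (∀ (a : ℂ) (f : UnitaryGroup.localPi L (IsCMField.complexConj L) (1 + 1) JD₁ v → ℂ), I (a • f) = a * I f) ∧
      (∀ f : UnitaryGroup.localPi L (IsCMField.complexConj L) (1 + 1) JD₁ v → ℂ, Continuous f →
        (∀ (p : P) (x : UnitaryGroup.localPi L (IsCMField.complexConj L) (1 + 1) JD₁ v),
          f ((p : UnitaryGroup.localPi L (IsCMField.complexConj L) (1 + 1) JD₁ v) * x) =
            ((Measure.modularCharacter p : ℝ) : ℂ) * f x) →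
        ∀ h : UnitaryGroup.localPi L (IsCMField.complexConj L) (1 + 1) JD₁ v, I (fun x => f (x * h)) = I f) ∧
      (∀ f : UnitaryGroup.localPi L (IsCMField.complexConj L) (1 + 1) JD₁ v → ℂ, Continuous f →
        (∀ (p : P) (x : UnitaryGroup.localPi L (IsCMField.complexConj L) (1 + 1) JD₁ v),
          f ((p : UnitaryGroup.localPi L (IsCMField.complexConj L) (1 + 1) JD₁ v) * x) =
            ((Measure.modularCharacter p : ℝ) : ℂ) * f x) →
        (∀ x, f x = ((f x).re : ℂ) ∧ 0 ≤ (f x).re) → ∀ x₀, f x₀ ≠ 0 → 0 < (I f).re) := by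
  haveI := isMulRightInvariant_localPi_gramD_one L v hT₁ hT₁d hJD₁ μ
  exact exists_rightInvariant_functional_of_isSiegelDelta (↥(maximalRealSubfield L)) L (IsCMField.complexConj L)
    (complexConj_imagUnit L) (imagUnit_ne_zero L) (imagUnit_mul_self L) v hT₁ hT₁d hJ₁ hJD₁ hE μ P hP

end CM

end Literature.NumberTheory.GelbartRogawski1991.UnitaryDualPair.LocalSplitting

end
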